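import Summits.CriticalPhenomena.PercolationContinuityZ3.Theorems.PercNearOneGluingNoHeavyLowerTailKnQuestion8CoefficientwiseStarClass
import HarnessLib

/-!
# The signable `u`-star classes of the two-point exclusion `Q_mix(p,q)` for `f = 1_u` — prim-lf-2 gen 49

Support file (`--supports stmt-CriticalPhenomena-4575`, closed), prover `prim-lf-2` (gen 49).  No definitions, no named facts, no sorries; standard axioms.
Memo `prim-lf-2/CW-ANATOMY-gen49.md` §1; context `prim-lf-2/CW-HT-gen48.md` §3c, §8(5) (CONJECTURE Q_mix: `prim-lf-2/CW-QMIX-gen47.md`).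

Setting.  Finite multigraph `ends : ι → Sym2 V`, root `x`, `K(s) = openCluster (ends '' s) x`; for monotone `g` the two-point exclusion with `f = 1_u` is
`Q_mix(p,q)[1_u, g] = Σ_{s : ¬(p ∈ K s ∧ q ∈ K sᶜ)} ([u ∈ K s] − [u ∈ K sᶜ])·(g(K s) − g(K sᶜ))` (CONJECTURE Q_mix: `≥ 0`; gen 48 proved it when `u ∈ {p, q}`).
Resolve a set `D` of edges AT `u` (every edge of `D` contains `u`): for `R ⊆ D` (the red ones) and `r` in the sub-cube `Finset {j // j ∉ D}` put
`a(r) = K(r⁺ ∪ R)`, `b(r) = K((rᶜ)⁺ ∪ (D ∖ R))`; the CLASS SUM is `C_R := Σ_r [¬(p ∈ a r ∧ q ∈ b r)]·([u ∈ a r] − [u ∈ b r])·(g(a r) − g(b r))` and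
`Q_mix(p,q)[1_u,g] = Σ_{R ⊆ D} C_R`.  THEOREMS (the four brackets of gen 48 — two antithetic kernels `AntitheticProduct.sum_mul_sub_compl_nonneg` and two termwise
inactive-star comparisons `openCluster_union_star_subset` — after folding the `u`-blue-only part through `r ↦ rᶜ`):
* `qmixStarClass_nonneg_of_red`      — if an edge `e₀ ∈ R` joins `u` to `p` (the edge `up` is RED in the class), then `C_R ≥ 0` for every `q` and every monotone `g`
  (tie `[p ∈ a] = [u ∈ a]`: on `{u ∈ a ∖ b}` the exclusion is the monotone event `{q ∉ b}`, on `{u ∈ b ∖ a}` it is automatic);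
* `qmixStarClass_nonneg_of_blue_blue` — if edges `e₀, e₁ ∈ D ∖ R` join `u` to `p` and to `q` (both BLUE in the class), then `C_R ≥ 0`
  (ties `[p ∈ b] = [q ∈ b] = [u ∈ b]`: the exclusion is automatic on `{u ∈ a ∖ b}` and equals `{p ∉ a}` on `{u ∈ b ∖ a}`, which folds to the monotone `{p ∉ b′}`);
* `sum_filter_mem_eq_sum_subcube` (bookkeeping) and `qmix_redHalf_nonneg_of_adj` — for `u ∼ p` through `e₀`, the `e₀`-RED HALF of `Q_mix(p,q)[1_u,g]`,
  `Σ_{s ∋ e₀} [¬(p ∈ K s ∧ q ∈ K sᶜ)]·σ_u·ĝ`, is `≥ 0` on every finite multigraph, for every `q` and every monotone `g` (`D = R = {e₀}`).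
So for `p, q ∈ N(u)` three of the four classes of `D = {up, uq}` are signed; the class `{up blue, uq red}` (and, for `q ∉ N(u)`, the `up`-blue half) is NOT signable
by these brackets: it contains the wall colourings `{p ∉ K ∪ K̄}` and is, as a stand-alone inequality over all multigraphs, as strong as the point row at `p`
(memo §2: attaching `q` to `x` by `k` parallel edges turns it into `2^k(½·WALL(p)[1_u,g] + 2^{-k}·kernel)`).  Exact checks (prim-lf-2 code/gen49/c/udecomp.c, famtest.c):
the signed classes are `≥ 0` in all instances on ≤ 6 vertices (all monotone `g` on ≤ 5 vertices, exact min over `g` by lattice min-closure); the `e₀`-blue half is negative in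
783 / 165 720 point instances on 6 vertices while `Q_mix ≥ 0` throughout.
[cite: KozmaNitzan2024, Questions 8–9 (§5.5 p. 36) (context: the Question-8 pocket covariance programme)]
-/

namespace Summit.CriticalPhenomena.PercolationContinuityZ3.Theorems

open Finset Literature.Probability.Percolation

namespace Coefficientwise

variable {ι V : Type*} [Fintype ι] [DecidableEq ι] (ends : ι → Sym2 V) (x : V)

open Classical in
/-- **`u`-star classes with the edge `up` RED are nonnegative.**  Let every edge of `D` contain `u`, `R ⊆ D`, and let `e₀ ∈ R` have ends `{u, p}`, `p ≠ u`.  For the sub-cube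
`r : Finset {j // j ∉ D}` put `a(r) = K(r⁺ ∪ R)`, `b(r) = K((rᶜ)⁺ ∪ (D ∖ R))`.  Then for every vertex `q` and every monotone `g`:
`0 ≤ Σ_r [¬(p ∈ a r ∧ q ∈ b r)]·([u ∈ a r] − [u ∈ b r])·(g(a r) − g(b r))`.  (Four brackets: `Σ E₁(g a − g a∘ᶜ) + Σ E₁(g b′ − g b) + Σ E₂(g a′ − g a′∘ᶜ) + Σ E₂(g b − g b′)`,
`E₁ = [u∈a][u∉b][q∉b]`, `E₂ = [u∈a′][u∉b′]`, with `a′ = K(r⁺ ∪ (D∖R))`, `b′ = K((rᶜ)⁺ ∪ R)`; the stars `D∖R`, `R` at `u` are inactive on `{u ∉ b}`, `{u ∉ b′}`.)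
[cite: KozmaNitzan2024, Questions 8–9 (§5.5 p. 36) (context)] -/
theorem qmixStarClass_nonneg_of_red (D R : Finset ι) (hRD : R ⊆ D) {u p : V} (hD : ∀ i ∈ D, u ∈ ends i)
    {e₀ : ι} (he₀ : ends e₀ = s(u, p)) (hpu : p ≠ u) (he₀R : e₀ ∈ R) (q : V) (g : Set V → ℝ) (hg : Monotone g) :
    0 ≤ ∑ r : Finset {j : ι // j ∉ D},
      (if ¬ (p ∈ openCluster (ends '' (↑(r.map (Function.Embedding.subtype _) ∪ R) : Set ι)) x ∧
              q ∈ openCluster (ends '' (↑(rᶜ.map (Function.Embedding.subtype _) ∪ (D \ R)) : Set ι)) x) then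
        ((if u ∈ openCluster (ends '' (↑(r.map (Function.Embedding.subtype _) ∪ R) : Set ι)) x then (1 : ℝ) else 0) -
          (if u ∈ openCluster (ends '' (↑(rᶜ.map (Function.Embedding.subtype _) ∪ (D \ R)) : Set ι)) x then (1 : ℝ) else 0)) *
        (g (openCluster (ends '' (↑(r.map (Function.Embedding.subtype _) ∪ R) : Set ι)) x) -
          g (openCluster (ends '' (↑(rᶜ.map (Function.Embedding.subtype _) ∪ (D \ R)) : Set ι)) x))
      else 0) := by
  set emb := Function.Embedding.subtype (fun j : ι => j ∉ D) with hemb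
  set a : Finset {j : ι // j ∉ D} → Set V := fun r => openCluster (ends '' (↑(r.map emb ∪ R) : Set ι)) x with ha
  set a' : Finset {j : ι // j ∉ D} → Set V := fun r => openCluster (ends '' (↑(r.map emb ∪ (D \ R)) : Set ι)) x with ha'
  change 0 ≤ ∑ r : Finset {j : ι // j ∉ D}, (if ¬ (p ∈ a r ∧ q ∈ a' rᶜ) then
    ((if u ∈ a r then (1 : ℝ) else 0) - (if u ∈ a' rᶜ then (1 : ℝ) else 0)) * (g (a r) - g (a' rᶜ)) else 0)
  -- monotonicity
  have hmono_union : ∀ {r t : Finset {j : ι // j ∉ D}} (X : Finset ι), r ⊆ t → r.map emb ∪ X ⊆ t.map emb ∪ X :=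
    fun X hrt => Finset.union_subset_union (Finset.map_subset_map.mpr hrt) (le_refl X)
  have ha_mono : Monotone a := fun r t hrt => openCluster_image_mono ends (hmono_union R hrt) x
  have ha'_mono : Monotone a' := fun r t hrt => openCluster_image_mono ends (hmono_union (D \ R) hrt) x
  -- tie: [u ∈ a r] ↔ [p ∈ a r] (the red edge e₀ ∈ R)
  have hua : ∀ r, u ∈ a r ↔ p ∈ a r := fun r =>
    mem_openCluster_iff_of_edge ends x (r.map emb ∪ R) he₀ hpu (Finset.mem_union_right _ he₀R)
  -- inactive stars at u
  have hDR : ∀ i ∈ D \ R, u ∈ ends i := fun i hi => hD i (Finset.mem_sdiff.mp hi).1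
  have hRu : ∀ i ∈ R, u ∈ ends i := fun i hi => hD i (hRD hi)
  have inact1 : ∀ t : Finset {j : ι // j ∉ D}, u ∉ a' t → a' t ⊆ a t := by
    intro t hu v hv
    have h1 := openCluster_union_star_subset ends x (t.map emb) (D \ R) hDR hu hv
    exact openCluster_image_mono ends Finset.subset_union_left x h1
  have inact2 : ∀ t : Finset {j : ι // j ∉ D}, u ∉ a t → a t ⊆ a' t := by
    intro t hu v hv
    have h1 := openCluster_union_star_subset ends x (t.map emb) R hRu hu hv
    exact openCluster_image_mono ends Finset.subset_union_left x h1
  -- the weights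
  set E₁ : Finset {j : ι // j ∉ D} → ℝ := fun r => if (u ∈ a r ∧ u ∉ a' rᶜ ∧ q ∉ a' rᶜ) then (1 : ℝ) else 0 with hE₁
  set E₂ : Finset {j : ι // j ∉ D} → ℝ := fun r => if (u ∈ a' r ∧ u ∉ a rᶜ) then (1 : ℝ) else 0 with hE₂
  set N₂ : Finset {j : ι // j ∉ D} → ℝ := fun r => if (u ∉ a r ∧ u ∈ a' rᶜ) then (1 : ℝ) else 0 with hN₂
  -- pointwise: summand = E₁·(g a − g b) − N₂·(g a − g b)
  have hpt : ∀ r : Finset {j : ι // j ∉ D}, (if ¬ (p ∈ a r ∧ q ∈ a' rᶜ) then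
      ((if u ∈ a r then (1 : ℝ) else 0) - (if u ∈ a' rᶜ then (1 : ℝ) else 0)) * (g (a r) - g (a' rᶜ)) else 0) =
      E₁ r * (g (a r) - g (a' rᶜ)) - N₂ r * (g (a r) - g (a' rᶜ)) := by
    intro r
    simp only [hE₁, hN₂, ← hua r]
    by_cases h1 : u ∈ a r <;> by_cases h2 : u ∈ a' rᶜ <;> by_cases h3 : q ∈ a' rᶜ <;> simp [h1, h2, h3]
  rw [Finset.sum_congr rfl (fun r _ => hpt r), Finset.sum_sub_distrib]
  -- fold the N₂ part through the swap r ↦ rᶜ: it becomes −Σ E₂·(g a′ − g b′)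
  have hswap : ∑ r : Finset {j : ι // j ∉ D}, N₂ r * (g (a r) - g (a' rᶜ)) = - ∑ r : Finset {j : ι // j ∉ D}, E₂ r * (g (a' r) - g (a rᶜ)) := by
    rw [← Fintype.sum_equiv (Equiv.mk (fun r : Finset {j : ι // j ∉ D} => rᶜ) (fun r => rᶜ) (fun r => compl_compl r) (fun r => compl_compl r))
      (fun r => N₂ rᶜ * (g (a rᶜ) - g (a' rᶜᶜ))) (fun r => N₂ r * (g (a r) - g (a' rᶜ))) (fun r => by simp only [Equiv.coe_fn_mk]),
      ← Finset.sum_neg_distrib]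
    refine Finset.sum_congr rfl fun r _ => ?_
    have hNE : N₂ rᶜ = E₂ r := by
      simp only [hN₂, hE₂, compl_compl]
      by_cases h1 : u ∈ a' r <;> by_cases h2 : u ∈ a rᶜ <;> simp [h1, h2]
    rw [hNE, compl_compl]; ring
  rw [hswap, sub_neg_eq_add]
  -- the four brackets
  have hE₁_mono : Monotone E₁ := by
    intro r t hrt
    simp only [hE₁]
    by_cases hr : u ∈ a r ∧ u ∉ a' rᶜ ∧ q ∉ a' rᶜ
    · have hc : a' tᶜ ⊆ a' rᶜ := ha'_mono (compl_subset_compl.mpr hrt)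
      have ht : u ∈ a t ∧ u ∉ a' tᶜ ∧ q ∉ a' tᶜ := ⟨ha_mono hrt hr.1, fun h => hr.2.1 (hc h), fun h => hr.2.2 (hc h)⟩
      simp [hr, ht]
    · simp only [hr, if_false]; split_ifs <;> norm_num
  have hE₂_mono : Monotone E₂ := by
    intro r t hrt
    simp only [hE₂]
    by_cases hr : u ∈ a' r ∧ u ∉ a rᶜ
    · have hc : a tᶜ ⊆ a rᶜ := ha_mono (compl_subset_compl.mpr hrt)
      have ht : u ∈ a' t ∧ u ∉ a tᶜ := ⟨ha'_mono hrt hr.1, fun h => hr.2 (hc h)⟩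
      simp [hr, ht]
    · simp only [hr, if_false]; split_ifs <;> norm_num
  have hB1 : 0 ≤ ∑ r : Finset {j : ι // j ∉ D}, E₁ r * (g (a r) - g (a rᶜ)) :=
    AntitheticProduct.sum_mul_sub_compl_nonneg E₁ (fun r => g (a r)) hE₁_mono (fun r t hrt => hg (ha_mono hrt))
  have hB2 : 0 ≤ ∑ r : Finset {j : ι // j ∉ D}, E₁ r * (g (a rᶜ) - g (a' rᶜ)) := by
    refine Finset.sum_nonneg fun r _ => ?_
    simp only [hE₁]
    split_ifs with h
    · have hsub : a' rᶜ ⊆ a rᶜ := inact1 rᶜ h.2.1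
      have := hg hsub
      linarith
    · simp
  have hB3 : 0 ≤ ∑ r : Finset {j : ι // j ∉ D}, E₂ r * (g (a' r) - g (a' rᶜ)) :=
    AntitheticProduct.sum_mul_sub_compl_nonneg E₂ (fun r => g (a' r)) hE₂_mono (fun r t hrt => hg (ha'_mono hrt))
  have hB4 : 0 ≤ ∑ r : Finset {j : ι // j ∉ D}, E₂ r * (g (a' rᶜ) - g (a rᶜ)) := by
    refine Finset.sum_nonneg fun r _ => ?_
    simp only [hE₂]
    split_ifs with h
    · have hsub : a rᶜ ⊆ a' rᶜ := inact2 rᶜ h.2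
      have := hg hsub
      linarith
    · simp
  have hsplit1 : ∑ r : Finset {j : ι // j ∉ D}, E₁ r * (g (a r) - g (a' rᶜ)) =
      ∑ r : Finset {j : ι // j ∉ D}, E₁ r * (g (a r) - g (a rᶜ)) + ∑ r : Finset {j : ι // j ∉ D}, E₁ r * (g (a rᶜ) - g (a' rᶜ)) := by
    rw [← Finset.sum_add_distrib]; refine Finset.sum_congr rfl fun r _ => ?_; ring
  have hsplit2 : ∑ r : Finset {j : ι // j ∉ D}, E₂ r * (g (a' r) - g (a rᶜ)) =
      ∑ r : Finset {j : ι // j ∉ D}, E₂ r * (g (a' r) - g (a' rᶜ)) + ∑ r : Finset {j : ι // j ∉ D}, E₂ r * (g (a' rᶜ) - g (a rᶜ)) := by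
    rw [← Finset.sum_add_distrib]; refine Finset.sum_congr rfl fun r _ => ?_; ring
  rw [hsplit1, hsplit2]
  linarith

open Classical in
/-- **`u`-star classes with BOTH edges `up` and `uq` BLUE are nonnegative.**  Let every edge of `D` contain `u`, `R ⊆ D`, and let `e₀, e₁ ∈ D ∖ R` have ends `{u, p}` and
`{u, q}` (`p ≠ u`, `q ≠ u`; `p = q`, `e₀ = e₁` allowed).  With `a(r) = K(r⁺ ∪ R)`, `b(r) = K((rᶜ)⁺ ∪ (D ∖ R))`, for every monotone `g`:
`0 ≤ Σ_r [¬(p ∈ a r ∧ q ∈ b r)]·([u ∈ a r] − [u ∈ b r])·(g(a r) − g(b r))`.  (Ties `[p ∈ b] = [q ∈ b] = [u ∈ b]`: on `{u ∈ a ∖ b}` the exclusion is automatic, on `{u ∈ b ∖ a}`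
it is `{p ∉ a}`, which the swap `r ↦ rᶜ` turns into the monotone `{p ∉ b′}`; then the same four brackets.)  [cite: KozmaNitzan2024, Questions 8–9 (§5.5 p. 36) (context)] -/
theorem qmixStarClass_nonneg_of_blue_blue (D R : Finset ι) (hRD : R ⊆ D) {u p q : V} (hD : ∀ i ∈ D, u ∈ ends i)
    {e₀ e₁ : ι} (he₀ : ends e₀ = s(u, p)) (hpu : p ≠ u) (he₀D : e₀ ∈ D \ R) (he₁ : ends e₁ = s(u, q)) (hqu : q ≠ u) (he₁D : e₁ ∈ D \ R)
    (g : Set V → ℝ) (hg : Monotone g) :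
    0 ≤ ∑ r : Finset {j : ι // j ∉ D},
      (if ¬ (p ∈ openCluster (ends '' (↑(r.map (Function.Embedding.subtype _) ∪ R) : Set ι)) x ∧
              q ∈ openCluster (ends '' (↑(rᶜ.map (Function.Embedding.subtype _) ∪ (D \ R)) : Set ι)) x) then
        ((if u ∈ openCluster (ends '' (↑(r.map (Function.Embedding.subtype _) ∪ R) : Set ι)) x then (1 : ℝ) else 0) -
          (if u ∈ openCluster (ends '' (↑(rᶜ.map (Function.Embedding.subtype _) ∪ (D \ R)) : Set ι)) x then (1 : ℝ) else 0)) *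
        (g (openCluster (ends '' (↑(r.map (Function.Embedding.subtype _) ∪ R) : Set ι)) x) -
          g (openCluster (ends '' (↑(rᶜ.map (Function.Embedding.subtype _) ∪ (D \ R)) : Set ι)) x))
      else 0) := by
  set emb := Function.Embedding.subtype (fun j : ι => j ∉ D) with hemb
  set a : Finset {j : ι // j ∉ D} → Set V := fun r => openCluster (ends '' (↑(r.map emb ∪ R) : Set ι)) x with ha
  set a' : Finset {j : ι // j ∉ D} → Set V := fun r => openCluster (ends '' (↑(r.map emb ∪ (D \ R)) : Set ι)) x with ha'
  change 0 ≤ ∑ r : Finset {j : ι // j ∉ D}, (if ¬ (p ∈ a r ∧ q ∈ a' rᶜ) then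
    ((if u ∈ a r then (1 : ℝ) else 0) - (if u ∈ a' rᶜ then (1 : ℝ) else 0)) * (g (a r) - g (a' rᶜ)) else 0)
  have hmono_union : ∀ {r t : Finset {j : ι // j ∉ D}} (X : Finset ι), r ⊆ t → r.map emb ∪ X ⊆ t.map emb ∪ X :=
    fun X hrt => Finset.union_subset_union (Finset.map_subset_map.mpr hrt) (le_refl X)
  have ha_mono : Monotone a := fun r t hrt => openCluster_image_mono ends (hmono_union R hrt) x
  have ha'_mono : Monotone a' := fun r t hrt => openCluster_image_mono ends (hmono_union (D \ R) hrt) x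
  -- ties in the blue cluster a' t = K(t⁺ ∪ (D∖R)): [p ∈ a' t] ↔ [u ∈ a' t] ↔ [q ∈ a' t]
  have hpa' : ∀ t, u ∈ a' t ↔ p ∈ a' t := fun t =>
    mem_openCluster_iff_of_edge ends x (t.map emb ∪ (D \ R)) he₀ hpu (Finset.mem_union_right _ he₀D)
  have hqa' : ∀ t, u ∈ a' t ↔ q ∈ a' t := fun t =>
    mem_openCluster_iff_of_edge ends x (t.map emb ∪ (D \ R)) he₁ hqu (Finset.mem_union_right _ he₁D)
  have hDR : ∀ i ∈ D \ R, u ∈ ends i := fun i hi => hD i (Finset.mem_sdiff.mp hi).1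
  have hRu : ∀ i ∈ R, u ∈ ends i := fun i hi => hD i (hRD hi)
  have inact1 : ∀ t : Finset {j : ι // j ∉ D}, u ∉ a' t → a' t ⊆ a t := by
    intro t hu v hv
    have h1 := openCluster_union_star_subset ends x (t.map emb) (D \ R) hDR hu hv
    exact openCluster_image_mono ends Finset.subset_union_left x h1
  have inact2 : ∀ t : Finset {j : ι // j ∉ D}, u ∉ a t → a t ⊆ a' t := by
    intro t hu v hv
    have h1 := openCluster_union_star_subset ends x (t.map emb) R hRu hu hv
    exact openCluster_image_mono ends Finset.subset_union_left x h1
  set E₁ : Finset {j : ι // j ∉ D} → ℝ := fun r => if (u ∈ a r ∧ u ∉ a' rᶜ) then (1 : ℝ) else 0 with hE₁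
  set E₂ : Finset {j : ι // j ∉ D} → ℝ := fun r => if (u ∈ a' r ∧ u ∉ a rᶜ ∧ p ∉ a rᶜ) then (1 : ℝ) else 0 with hE₂
  set N₂ : Finset {j : ι // j ∉ D} → ℝ := fun r => if (u ∉ a r ∧ u ∈ a' rᶜ ∧ p ∉ a r) then (1 : ℝ) else 0 with hN₂
  have hpt : ∀ r : Finset {j : ι // j ∉ D}, (if ¬ (p ∈ a r ∧ q ∈ a' rᶜ) then
      ((if u ∈ a r then (1 : ℝ) else 0) - (if u ∈ a' rᶜ then (1 : ℝ) else 0)) * (g (a r) - g (a' rᶜ)) else 0) =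
      E₁ r * (g (a r) - g (a' rᶜ)) - N₂ r * (g (a r) - g (a' rᶜ)) := by
    intro r
    simp only [hE₁, hN₂, ← hqa' rᶜ]
    by_cases h1 : u ∈ a r <;> by_cases h2 : u ∈ a' rᶜ <;> by_cases h3 : p ∈ a r <;> simp [h1, h2, h3]
  rw [Finset.sum_congr rfl (fun r _ => hpt r), Finset.sum_sub_distrib]
  have hswap : ∑ r : Finset {j : ι // j ∉ D}, N₂ r * (g (a r) - g (a' rᶜ)) = - ∑ r : Finset {j : ι // j ∉ D}, E₂ r * (g (a' r) - g (a rᶜ)) := by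
    rw [← Fintype.sum_equiv (Equiv.mk (fun r : Finset {j : ι // j ∉ D} => rᶜ) (fun r => rᶜ) (fun r => compl_compl r) (fun r => compl_compl r))
      (fun r => N₂ rᶜ * (g (a rᶜ) - g (a' rᶜᶜ))) (fun r => N₂ r * (g (a r) - g (a' rᶜ))) (fun r => by simp only [Equiv.coe_fn_mk]),
      ← Finset.sum_neg_distrib]
    refine Finset.sum_congr rfl fun r _ => ?_
    have hNE : N₂ rᶜ = E₂ r := by
      simp only [hN₂, hE₂, compl_compl]
      by_cases h1 : u ∈ a' r <;> by_cases h2 : u ∈ a rᶜ <;> by_cases h3 : p ∈ a rᶜ <;> simp [h1, h2, h3]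
    rw [hNE, compl_compl]; ring
  rw [hswap, sub_neg_eq_add]
  have hE₁_mono : Monotone E₁ := by
    intro r t hrt
    simp only [hE₁]
    by_cases hr : u ∈ a r ∧ u ∉ a' rᶜ
    · have hc : a' tᶜ ⊆ a' rᶜ := ha'_mono (compl_subset_compl.mpr hrt)
      have ht : u ∈ a t ∧ u ∉ a' tᶜ := ⟨ha_mono hrt hr.1, fun h => hr.2 (hc h)⟩
      simp [hr, ht]
    · simp only [hr, if_false]; split_ifs <;> norm_num
  have hE₂_mono : Monotone E₂ := by
    intro r t hrt
    simp only [hE₂]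
    by_cases hr : u ∈ a' r ∧ u ∉ a rᶜ ∧ p ∉ a rᶜ
    · have hc : a tᶜ ⊆ a rᶜ := ha_mono (compl_subset_compl.mpr hrt)
      have ht : u ∈ a' t ∧ u ∉ a tᶜ ∧ p ∉ a tᶜ := ⟨ha'_mono hrt hr.1, fun h => hr.2.1 (hc h), fun h => hr.2.2 (hc h)⟩
      simp [hr, ht]
    · simp only [hr, if_false]; split_ifs <;> norm_num
  have hB1 : 0 ≤ ∑ r : Finset {j : ι // j ∉ D}, E₁ r * (g (a r) - g (a rᶜ)) :=
    AntitheticProduct.sum_mul_sub_compl_nonneg E₁ (fun r => g (a r)) hE₁_mono (fun r t hrt => hg (ha_mono hrt))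
  have hB2 : 0 ≤ ∑ r : Finset {j : ι // j ∉ D}, E₁ r * (g (a rᶜ) - g (a' rᶜ)) := by
    refine Finset.sum_nonneg fun r _ => ?_
    simp only [hE₁]
    split_ifs with h
    · have hsub : a' rᶜ ⊆ a rᶜ := inact1 rᶜ h.2
      have := hg hsub
      linarith
    · simp
  have hB3 : 0 ≤ ∑ r : Finset {j : ι // j ∉ D}, E₂ r * (g (a' r) - g (a' rᶜ)) :=
    AntitheticProduct.sum_mul_sub_compl_nonneg E₂ (fun r => g (a' r)) hE₂_mono (fun r t hrt => hg (ha'_mono hrt))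
  have hB4 : 0 ≤ ∑ r : Finset {j : ι // j ∉ D}, E₂ r * (g (a' rᶜ) - g (a rᶜ)) := by
    refine Finset.sum_nonneg fun r _ => ?_
    simp only [hE₂]
    split_ifs with h
    · have hsub : a rᶜ ⊆ a' rᶜ := inact2 rᶜ h.2.1
      have := hg hsub
      linarith
    · simp
  have hsplit1 : ∑ r : Finset {j : ι // j ∉ D}, E₁ r * (g (a r) - g (a' rᶜ)) =
      ∑ r : Finset {j : ι // j ∉ D}, E₁ r * (g (a r) - g (a rᶜ)) + ∑ r : Finset {j : ι // j ∉ D}, E₁ r * (g (a rᶜ) - g (a' rᶜ)) := by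
    rw [← Finset.sum_add_distrib]; refine Finset.sum_congr rfl fun r _ => ?_; ring
  have hsplit2 : ∑ r : Finset {j : ι // j ∉ D}, E₂ r * (g (a' r) - g (a rᶜ)) =
      ∑ r : Finset {j : ι // j ∉ D}, E₂ r * (g (a' r) - g (a' rᶜ)) + ∑ r : Finset {j : ι // j ∉ D}, E₂ r * (g (a' rᶜ) - g (a rᶜ)) := by
    rw [← Finset.sum_add_distrib]; refine Finset.sum_congr rfl fun r _ => ?_; ring
  rw [hsplit1, hsplit2]
  linarith


/-- Complement of `r⁺ ∪ {e₀}` inside the whole cube: `(r.map emb ∪ {e₀})ᶜ = rᶜ.map emb ∪ ({e₀} ∖ {e₀})` (bookkeeping for the sub-cube `{j // j ∉ {e₀}}`).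
[cite: KozmaNitzan2024, §5.5 (context only; bookkeeping)] -/
theorem compl_map_union_singleton (e₀ : ι) (r : Finset {j : ι // j ∉ ({e₀} : Finset ι)}) :
    (r.map (Function.Embedding.subtype _) ∪ {e₀})ᶜ =
      rᶜ.map (Function.Embedding.subtype _) ∪ (({e₀} : Finset ι) \ {e₀}) := by
  set Pr : ι → Prop := fun j => j ∉ ({e₀} : Finset ι) with hPr
  set emb := Function.Embedding.subtype Pr with hemb
  rw [Finset.sdiff_self, Finset.union_empty]
  ext a
  rw [Finset.mem_compl, Finset.mem_union, Finset.mem_singleton]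
  constructor
  · intro h
    have ha : a ≠ e₀ := fun hae => h (Or.inr hae)
    have hPa : Pr a := by simpa [hPr] using ha
    refine Finset.mem_map.mpr ⟨⟨a, hPa⟩, ?_, rfl⟩
    rw [Finset.mem_compl]
    intro har
    exact h (Or.inl (Finset.mem_map.mpr ⟨⟨a, hPa⟩, har, rfl⟩))
  · intro h h'
    obtain ⟨b, hb, hba⟩ := Finset.mem_map.mp h
    rcases h' with h' | h'
    · obtain ⟨c, hc, hca⟩ := Finset.mem_map.mp h'
      have : b = c := Subtype.ext (by rw [show (b : ι) = a from hba, show (c : ι) = a from hca])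
      exact (Finset.mem_compl.mp hb) (this ▸ hc)
    · exact b.2 (by rw [show (b : ι) = a from hba, h']; exact Finset.mem_singleton_self _)

open Classical in
/-- **Reindexing the colourings containing `e₀` by the sub-cube of the other edges:** `Σ_{s ∋ e₀} Ψ(s) = Σ_{r : Finset {j // j ∉ {e₀}}} Ψ(r⁺ ∪ {e₀})`.
[cite: KozmaNitzan2024, §5.5 (context only; bookkeeping)] -/
theorem sum_filter_mem_eq_sum_subcube (e₀ : ι) (Ψ : Finset ι → ℝ) :
    ∑ s ∈ univ.filter (fun s : Finset ι => e₀ ∈ s), Ψ s =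
      ∑ r : Finset {j : ι // j ∉ ({e₀} : Finset ι)}, Ψ (r.map (Function.Embedding.subtype _) ∪ {e₀}) := by
  set Pr : ι → Prop := fun j => j ∉ ({e₀} : Finset ι) with hPr
  set emb := Function.Embedding.subtype Pr with hemb
  set jj : Finset {j : ι // Pr j} → Finset ι := fun r => r.map emb ∪ {e₀} with hjj
  change ∑ s ∈ univ.filter (fun s : Finset ι => e₀ ∈ s), Ψ s = ∑ r : Finset {j : ι // Pr j}, Ψ (jj r)
  have hleft : ∀ s ∈ univ.filter (fun s : Finset ι => e₀ ∈ s), jj (s.subtype Pr) = s := by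
    intro s hs
    have hs' : e₀ ∈ s := (Finset.mem_filter.mp hs).2
    rw [hjj]; simp only [hemb, Finset.subtype_map]
    ext a
    simp only [Finset.mem_union, Finset.mem_filter, Finset.mem_singleton, hPr]
    constructor
    · rintro (⟨ha, _⟩ | rfl); exact ha; exact hs'
    · intro ha; by_cases hae : a = e₀; exact Or.inr hae; exact Or.inl ⟨ha, hae⟩
  refine Finset.sum_nbij' (fun s => s.subtype Pr) jj ?_ ?_ hleft ?_ ?_
  · intro s _; exact Finset.mem_univ _
  · intro r _; exact Finset.mem_filter.mpr ⟨Finset.mem_univ _, by rw [hjj]; exact Finset.mem_union_right _ (Finset.mem_singleton_self _)⟩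
  · intro r _
    ext a
    rw [Finset.mem_subtype, hjj, Finset.mem_union, Finset.mem_singleton]
    constructor
    · rintro (ha | ha)
      · obtain ⟨b, hb, hba⟩ := Finset.mem_map.mp ha
        have : b = a := Subtype.ext hba
        exact this ▸ hb
      · exact absurd (ha ▸ Finset.mem_singleton_self e₀) a.2
    · intro ha; exact Or.inl (Finset.mem_map.mpr ⟨a, ha, rfl⟩)
  · intro s hs; rw [hleft s hs]

open Classical in
/-- **THEOREM: for `u ∼ p` the `up`-red half of `Q_mix(p,q)[1_u, g]` is nonnegative.**  Let the edge `e₀` have ends `{u, p}`, `p ≠ u`.  Then for every vertex `q`, every monotone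
`g : Set V → ℝ` and every finite multigraph:  `0 ≤ Σ_{s ∋ e₀} [¬(p ∈ K s ∧ q ∈ K sᶜ)]·([u ∈ K s] − [u ∈ K sᶜ])·(g(K s) − g(K sᶜ))`.
(`qmixStarClass_nonneg_of_red` with `D = R = {e₀}` after `sum_filter_mem_eq_sum_subcube`.)  The complementary `e₀`-blue half is NOT nonnegative in general (prim-lf-2 gen 48
uclass.c: 783 / 165 720 negative point instances on 6 vertices) although the total `Q_mix(p,q)[1_u,g]` is (CONJECTURE Q_mix, census-clean ≤ 8 vertices / 12 edges).
[cite: KozmaNitzan2024, Questions 8–9 (§5.5 p. 36) (context)] -/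
theorem qmix_redHalf_nonneg_of_adj {u p : V} {e₀ : ι} (he₀ : ends e₀ = s(u, p)) (hpu : p ≠ u) (q : V) (g : Set V → ℝ) (hg : Monotone g) :
    0 ≤ ∑ s ∈ univ.filter (fun s : Finset ι => e₀ ∈ s),
      (if ¬ (p ∈ openCluster (ends '' (↑s : Set ι)) x ∧ q ∈ openCluster (ends '' (↑(sᶜ) : Set ι)) x) then
        ((if u ∈ openCluster (ends '' (↑s : Set ι)) x then (1 : ℝ) else 0) - (if u ∈ openCluster (ends '' (↑(sᶜ) : Set ι)) x then (1 : ℝ) else 0)) *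
          (g (openCluster (ends '' (↑s : Set ι)) x) - g (openCluster (ends '' (↑(sᶜ) : Set ι)) x))
      else 0) := by
  set K : Finset ι → Set V := fun s => openCluster (ends '' (↑s : Set ι)) x with hK
  set Ψ : Finset ι → ℝ := fun s => if ¬ (p ∈ K s ∧ q ∈ K sᶜ) then
    ((if u ∈ K s then (1 : ℝ) else 0) - (if u ∈ K sᶜ then (1 : ℝ) else 0)) * (g (K s) - g (K sᶜ)) else 0 with hΨ
  change 0 ≤ ∑ s ∈ univ.filter (fun s : Finset ι => e₀ ∈ s), Ψ s
  rw [sum_filter_mem_eq_sum_subcube e₀ Ψ]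
  have hrw : ∀ r : Finset {j : ι // j ∉ ({e₀} : Finset ι)}, Ψ (r.map (Function.Embedding.subtype _) ∪ {e₀}) =
      (if ¬ (p ∈ K (r.map (Function.Embedding.subtype _) ∪ {e₀}) ∧
              q ∈ K (rᶜ.map (Function.Embedding.subtype _) ∪ (({e₀} : Finset ι) \ {e₀}))) then
        ((if u ∈ K (r.map (Function.Embedding.subtype _) ∪ {e₀}) then (1 : ℝ) else 0) -
          (if u ∈ K (rᶜ.map (Function.Embedding.subtype _) ∪ (({e₀} : Finset ι) \ {e₀})) then (1 : ℝ) else 0)) *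
        (g (K (r.map (Function.Embedding.subtype _) ∪ {e₀})) - g (K (rᶜ.map (Function.Embedding.subtype _) ∪ (({e₀} : Finset ι) \ {e₀}))))
      else 0) := by
    intro r; simp only [hΨ, compl_map_union_singleton e₀ r]
  rw [Finset.sum_congr rfl (fun r _ => hrw r)]
  have hD : ∀ i ∈ ({e₀} : Finset ι), u ∈ ends i := by
    intro i hi; rw [Finset.mem_singleton.mp hi, he₀]; exact Sym2.mem_mk_left u p
  exact qmixStarClass_nonneg_of_red ends x {e₀} {e₀} (subset_refl _) hD he₀ hpu (Finset.mem_singleton_self e₀) q g hg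

end Coefficientwise

end Summit.CriticalPhenomena.PercolationContinuityZ3.Theorems
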